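import Summits.ResolutionOfSingularities.ResolutionOfSingularities.Theorems.FrobeniusClosingNoPeriodicIsolatedAtomUnwindPd
import Mathlib.RingTheory.MvPowerSeries.Substitution

/-!
# The chain rule for `pd` under power-series substitution (crux `NoPeriodicIsolatedAtom`, line
# `ridge_rank`, lead's stub `stub_unwind` — infrastructure file 2)

For a substitution `Φ : Fin n → κ[[u]]` with `Φ j ∈ 𝔪` (zero constant coefficients) and the crux's
formal partial derivative `pd`, we prove

  `pd k (subst Φ f) = Σ_j subst Φ (pd j f) * pd k (Φ j)`            (`pd_subst`)

first for polynomials (induction on `MvPolynomial`, the Leibniz rule), then for all `f` by an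
`𝔪`-adic approximation: both sides are additive in `f`, agree on the total-degree truncation of `f`,
and have vanishing coefficient at `B` on any `g` of order `≥ deg B + 2` (`MvPowerSeries.le_order_subst`,
`le_order_mul`). Consequence for Jacobian ideals: `pd k (subst Φ f)` lies in the ideal generated by
the `subst Φ (pd j f)` (`pd_subst_mem_span`).
-/

noncomputable section

-- single-problem summit: the doubled namespace component is forced by the tree layout
set_option linter.dupNamespace false

namespace Summit.ResolutionOfSingularities.ResolutionOfSingularities.Theorems.NoPeriodicIsolatedAtom.Unwind

open Summit.ResolutionOfSingularities.ResolutionOfSingularities.Theorems.ConeExit.Negative (pd)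
open scoped BigOperators
open MvPowerSeries

variable {n : ℕ} {κ : Type} [Field κ]

/-- `pd` lowers the order by at most one: if `g` has no coefficients in total degree `< N`, then
`pd k g` has none in total degree `< N - 1`. [folklore] -/
theorem coeff_pd_eq_zero_of_lt (k : Fin n) (g : MvPowerSeries (Fin n) κ) (N : ℕ)
    (hg : ∀ d : Fin n →₀ ℕ, d.degree < N → coeff d g = 0) (d : Fin n →₀ ℕ) (hd : d.degree + 1 < N) :
    coeff d (pd k g) = 0 := by
  rw [coeff_pd, hg _ (by rwa [map_add, Finsupp.degree_single]), mul_zero]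

/-- Order version: `N ≤ order g` implies `N - 1 ≤ order (pd k g)` (stated without subtraction). [folklore] -/
theorem le_order_pd (k : Fin n) (g : MvPowerSeries (Fin n) κ) (N : ℕ) (hg : ((N + 1 : ℕ) : ℕ∞) ≤ g.order) :
    (N : ℕ∞) ≤ (pd k g).order := by
  refine nat_le_order fun d hd => coeff_pd_eq_zero_of_lt k g (N + 1) (fun e he => coeff_of_lt_order ?_) d (by omega)
  exact lt_of_lt_of_le (by exact_mod_cast he) hg

/-- Substitutions into `𝔪` have `HasSubst`. [folklore] -/
theorem hasSubst_of_mem (Φ : Fin n → MvPowerSeries (Fin n) κ) (hΦ : ∀ j, constantCoeff (Φ j) = 0) :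
    HasSubst Φ :=
  hasSubst_of_constantCoeff_zero hΦ

/-- Orders only grow under a substitution into `𝔪`: `order f ≤ order (subst Φ f)`. [folklore] -/
theorem order_le_order_subst (Φ : Fin n → MvPowerSeries (Fin n) κ) (hΦ : ∀ j, constantCoeff (Φ j) = 0)
    (f : MvPowerSeries (Fin n) κ) : f.order ≤ (subst Φ f).order := by
  refine le_trans ?_ (le_order_subst (hasSubst_of_mem Φ hΦ) f)
  have h1 : (1 : ℕ∞) ≤ ⨅ i, (Φ i).order :=
    le_iInf fun i => (one_le_order_iff_constCoeff_eq_zero).mpr (hΦ i)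
  calc f.order = 1 * f.order := (one_mul _).symm
    _ ≤ (⨅ i, (Φ i).order) * f.order := by gcongr

/-! ## The chain rule on polynomials -/

/-- The right-hand side of the chain rule, as a function of `f`. -/
private theorem rhs_add (Φ : Fin n → MvPowerSeries (Fin n) κ) (hΦ : ∀ j, constantCoeff (Φ j) = 0)
    (k : Fin n) (f g : MvPowerSeries (Fin n) κ) :
    ∑ j, subst Φ (pd j (f + g)) * pd k (Φ j) =
      ∑ j, subst Φ (pd j f) * pd k (Φ j) + ∑ j, subst Φ (pd j g) * pd k (Φ j) := by
  rw [← Finset.sum_add_distrib]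
  refine Finset.sum_congr rfl fun j _ => ?_
  rw [pd_add, subst_add (hasSubst_of_mem Φ hΦ), add_mul]

/-- **Chain rule on polynomials.** [folklore] -/
theorem pd_subst_coe (Φ : Fin n → MvPowerSeries (Fin n) κ) (hΦ : ∀ j, constantCoeff (Φ j) = 0)
    (k : Fin n) (P : MvPolynomial (Fin n) κ) :
    pd k (subst Φ (P : MvPowerSeries (Fin n) κ)) =
      ∑ j, subst Φ (pd j (P : MvPowerSeries (Fin n) κ)) * pd k (Φ j) := by
  have ha := hasSubst_of_mem Φ hΦ
  induction P using MvPolynomial.induction_on with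
  | C a =>
    rw [MvPolynomial.coe_C, subst_C, pd_C]
    symm
    refine Finset.sum_eq_zero fun j _ => ?_
    rw [pd_C, ← coe_substAlgHom ha, map_zero, zero_mul]
  | add P Q hP hQ =>
    rw [MvPolynomial.coe_add, subst_add ha, pd_add, hP, hQ, rhs_add Φ hΦ]
  | mul_X P l hP =>
    rw [MvPolynomial.coe_mul, MvPolynomial.coe_X, subst_mul ha, subst_X ha, pd_mul, hP]
    -- right-hand side: `pd j (P * X l) = pd j P * X l + P * pd j (X l)`
    have hrhs : ∑ j, subst Φ (pd j ((P : MvPowerSeries (Fin n) κ) * X l)) * pd k (Φ j) =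
        ∑ j, subst Φ (pd j (P : MvPowerSeries (Fin n) κ)) * Φ l * pd k (Φ j) +
          subst Φ (P : MvPowerSeries (Fin n) κ) * pd k (Φ l) := by
      have hsplit : ∀ j, subst Φ (pd j ((P : MvPowerSeries (Fin n) κ) * X l)) * pd k (Φ j) =
          subst Φ (pd j (P : MvPowerSeries (Fin n) κ)) * Φ l * pd k (Φ j) +
            subst Φ ((P : MvPowerSeries (Fin n) κ) * pd j (X l)) * pd k (Φ j) := by
        intro j
        rw [pd_mul, subst_add ha, subst_mul ha, subst_X ha, add_mul]
      rw [Finset.sum_congr rfl fun j _ => hsplit j, Finset.sum_add_distrib]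
      congr 1
      rw [Finset.sum_eq_single l]
      · rw [pd_X_self, mul_one]
      · intro j _ hjl
        rw [pd_X_of_ne (Ne.symm hjl), mul_zero, ← coe_substAlgHom ha, map_zero, zero_mul]
      · intro h; exact absurd (Finset.mem_univ l) h
    rw [hrhs, Finset.sum_mul]
    congr 1
    exact Finset.sum_congr rfl fun j _ => by ring

/-! ## The chain rule in general -/

/-- Coefficients of `pd k (subst Φ g)` vanish in degree `deg B` when `g` has order `≥ deg B + 2`. -/
private theorem coeff_pd_subst_eq_zero (Φ : Fin n → MvPowerSeries (Fin n) κ) (hΦ : ∀ j, constantCoeff (Φ j) = 0)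
    (k : Fin n) (g : MvPowerSeries (Fin n) κ) (B : Fin n →₀ ℕ)
    (hg : ((B.degree + 2 : ℕ) : ℕ∞) ≤ g.order) : coeff B (pd k (subst Φ g)) = 0 := by
  refine coeff_pd_eq_zero_of_lt k (subst Φ g) (B.degree + 2) (fun d hd => coeff_of_lt_order ?_) B (by omega)
  exact lt_of_lt_of_le (by exact_mod_cast hd) (le_trans hg (order_le_order_subst Φ hΦ g))

/-- Coefficients of `subst Φ (pd j g) * h` vanish in degree `deg B` when `g` has order `≥ deg B + 2`. -/
private theorem coeff_subst_pd_mul_eq_zero (Φ : Fin n → MvPowerSeries (Fin n) κ) (hΦ : ∀ j, constantCoeff (Φ j) = 0)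
    (j : Fin n) (g h : MvPowerSeries (Fin n) κ) (B : Fin n →₀ ℕ)
    (hg : ((B.degree + 2 : ℕ) : ℕ∞) ≤ g.order) : coeff B (subst Φ (pd j g) * h) = 0 := by
  apply coeff_of_lt_order
  have h1 : ((B.degree + 1 : ℕ) : ℕ∞) ≤ (subst Φ (pd j g)).order :=
    le_trans (le_order_pd j g (B.degree + 1) (by simpa [add_assoc] using hg)) (order_le_order_subst Φ hΦ _)
  calc ((B.degree : ℕ) : ℕ∞) < ((B.degree + 1 : ℕ) : ℕ∞) := by exact_mod_cast Nat.lt_succ_self _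
    _ ≤ (subst Φ (pd j g)).order := h1
    _ ≤ (subst Φ (pd j g)).order + h.order := le_self_add
    _ ≤ (subst Φ (pd j g) * h).order := le_order_mul

/-- **Chain rule** for the crux's formal partial derivatives under a substitution into `𝔪`:
`∂_k (f ∘ Φ) = Σ_j (∂_j f ∘ Φ) · ∂_k Φ_j`. [folklore] -/
theorem pd_subst (Φ : Fin n → MvPowerSeries (Fin n) κ) (hΦ : ∀ j, constantCoeff (Φ j) = 0)
    (k : Fin n) (f : MvPowerSeries (Fin n) κ) :
    pd k (subst Φ f) = ∑ j, subst Φ (pd j f) * pd k (Φ j) := by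
  have ha := hasSubst_of_mem Φ hΦ
  ext B
  -- split `f` into its truncation below total degree `N = deg B + 2` and a tail of order `≥ N`
  set N := B.degree + 2 with hN
  set T : MvPolynomial (Fin n) κ := truncTotal N f with hT
  set g := f - (T : MvPowerSeries (Fin n) κ) with hgdef
  have hfg : f = (T : MvPowerSeries (Fin n) κ) + g := by rw [hgdef]; ring
  have hg : ((N : ℕ) : ℕ∞) ≤ g.order := by
    refine nat_le_order fun d hd => ?_
    rw [hgdef, map_sub, MvPolynomial.coeff_coe, hT, coeff_truncTotal f hd, sub_self]
  rw [hfg, subst_add ha, pd_add, map_add, rhs_add Φ hΦ, map_add, pd_subst_coe Φ hΦ,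
    coeff_pd_subst_eq_zero Φ hΦ k g B hg]
  congr 1
  rw [map_sum]
  symm
  exact Finset.sum_eq_zero fun j _ => coeff_subst_pd_mul_eq_zero Φ hΦ j g _ B hg

/-- **Jacobian containment.** Every `∂_k (f ∘ Φ)` lies in the ideal generated by the `(∂_j f) ∘ Φ`. [folklore] -/
theorem pd_subst_mem_span (Φ : Fin n → MvPowerSeries (Fin n) κ) (hΦ : ∀ j, constantCoeff (Φ j) = 0)
    (k : Fin n) (f : MvPowerSeries (Fin n) κ) :
    pd k (subst Φ f) ∈ Ideal.span (Set.range fun j => subst Φ (pd j f)) := by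
  rw [pd_subst Φ hΦ k f]
  exact Ideal.sum_mem _ fun j _ => Ideal.mul_mem_right _ _ (Ideal.subset_span ⟨j, rfl⟩)

/-- **Registered helper goal `unwind_chain_rule`** (closed form of `pd_subst`). [folklore] -/
theorem unwind_chain_rule : ∀ {n : ℕ} {κ : Type} [Field κ] (Φ : Fin n → MvPowerSeries (Fin n) κ),
    (∀ j, MvPowerSeries.constantCoeff (Φ j) = 0) → ∀ (k : Fin n) (f : MvPowerSeries (Fin n) κ),
    pd k (MvPowerSeries.subst Φ f) = ∑ j, MvPowerSeries.subst Φ (pd j f) * pd k (Φ j) :=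
  fun Φ hΦ k f => pd_subst Φ hΦ k f

end Summit.ResolutionOfSingularities.ResolutionOfSingularities.Theorems.NoPeriodicIsolatedAtom.Unwind

end
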